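import Mathlib.Analysis.Calculus.FDeriv.Symmetric
import Mathlib.Analysis.Calculus.Deriv.Prod
import Mathlib.Analysis.Calculus.ContDiff.Basic
import Mathlib.Analysis.Calculus.IteratedDeriv.Lemmas
import HarnessLib

/-!
# Gluing a smooth function flat on a hyperplane to zero

Topic `Analysis/Calculus`. On a product `E × ℝ` (a real normed space times a time axis) let
`f` be `C^∞` on an open set `O` and **flat in time on the hyperplane `{t = 0}`**: all iterated
time derivatives `∂ₜᵏ f` vanish at the points of `O` with `t = 0`. Then the function cut off to
positive times, `z ↦ f z` for `t > 0` and `0` for `t ≤ 0`, is `C^∞` on `O`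
(`IsTFlatOn.contDiffOn_cutoff`). This is the calculus fact behind the reduction of a parabolic
initial value problem with smooth data to a forced problem with zero past (subtract a function
with the formal Taylor jet of the solution at `t = 0` and extend by zero), e.g. Hörmander,
*The Analysis of Linear Partial Differential Operators I*, Thm. 1.2.6 (Borel) and §7 usage; Evans,
*PDE*, §7.1.3 (compatibility conditions). Elementary and self-contained here:

* `tDeriv f z = Df(z)(0, 1)` — the partial time derivative as an operator on functions
  `E × ℝ → F`; `iterate_tDeriv_apply_eq_iteratedDeriv` identifies `∂ₜᵏ f (y, t)` with the `k`-th
  derivative of the slice `t ↦ f (y, t)`;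
* `tDeriv_fderiv` — **`∂ₜ` commutes with the total derivative** on an open set of smoothness
  (symmetry of the second derivative, Mathlib's `ContDiffAt.isSymmSndFDerivAt`), and its iterate
  `iterate_tDeriv_fderiv`;
* `IsTFlatOn O f` — flatness in time on `O ∩ {t = 0}`; it passes to the total derivative
  (`IsTFlatOn.fderiv`), and forces `f = 0`, `Df = 0` on the hyperplane;
* `IsTFlatOn.contDiffOn_cutoff` — the gluing theorem, by induction on the order of
  differentiability through `contDiffOn_succ_iff_fderiv_of_isOpen`: the cut-off function is
  differentiable with derivative the cut-off of `Df` (a little-`o` domination at the hyperplane),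
  and `Df` is again smooth and flat.

All statements are proved; two definitions (`tDeriv`, `IsTFlatOn`) with unfolding lemmas; no
named facts. `E` and `F` are taken in a common universe (the induction runs through
`F := E × ℝ →L[ℝ] F`).

## References

* L. Hörmander, *The Analysis of Linear Partial Differential Operators I*, 2nd ed., Springer
  1990, Thm. 1.2.6 and the remarks following it. [folklore]
* L. C. Evans, *Partial Differential Equations*, 2nd ed., AMS 2010, §5.6 and §7.1.3. [folklore]
-/

noncomputable section

open Set Function Filter Asymptotics
open scoped Topology ContDiff

namespace Literature.Analysis.Calculus

universe u

variable {E : Type u} [NormedAddCommGroup E] [NormedSpace ℝ E]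
  {F : Type u} [NormedAddCommGroup F] [NormedSpace ℝ F]

/-! ### The partial time derivative as an operator -/

/-- The partial derivative in the time variable of `f : E × ℝ → F`, as a function on `E × ℝ`:
`tDeriv f z = Df(z)(0, 1)`. [folklore] -/
def tDeriv (f : E × ℝ → F) (z : E × ℝ) : F :=
  fderiv ℝ f z ((0 : E), (1 : ℝ))

/-- Unfolding `tDeriv`. [folklore] -/
theorem tDeriv_apply (f : E × ℝ → F) (z : E × ℝ) : tDeriv f z = fderiv ℝ f z ((0 : E), (1 : ℝ)) :=
  rfl

/-- `tDeriv` is local: functions agreeing near `z` have the same time derivative at `z`.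
[folklore] -/
theorem tDeriv_congr_of_eventuallyEq {f g : E × ℝ → F} {z : E × ℝ} (h : f =ᶠ[𝓝 z] g) :
    tDeriv f z = tDeriv g z := by
  simp only [tDeriv_apply, h.fderiv_eq]

/-- Iterates of `tDeriv` are local on open sets. [folklore] -/
theorem iterate_tDeriv_eqOn {f g : E × ℝ → F} {O : Set (E × ℝ)} (hO : IsOpen O) (h : EqOn f g O)
    (k : ℕ) : EqOn (tDeriv^[k] f) (tDeriv^[k] g) O := by
  induction k with
  | zero => simpa using h
  | succ k ih =>
    intro z hz
    rw [iterate_succ_apply', iterate_succ_apply']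
    exact tDeriv_congr_of_eventuallyEq (eventuallyEq_of_mem (hO.mem_nhds hz) ih)

/-- The time derivative of a `C^∞` function is `C^∞` (on an open set). [folklore] -/
theorem _root_.ContDiffOn.tDeriv {f : E × ℝ → F} {O : Set (E × ℝ)} (hf : ContDiffOn ℝ ∞ f O)
    (hO : IsOpen O) : ContDiffOn ℝ ∞ (tDeriv f) O := by
  have h := (hf.fderiv_of_isOpen hO le_rfl : ContDiffOn ℝ ∞ (fun z ↦ fderiv ℝ f z) O)
  exact h.clm_apply contDiffOn_const

/-- Iterated time derivatives of a `C^∞` function are `C^∞`. [folklore] -/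
theorem _root_.ContDiffOn.iterate_tDeriv {f : E × ℝ → F} {O : Set (E × ℝ)}
    (hf : ContDiffOn ℝ ∞ f O) (hO : IsOpen O) (k : ℕ) : ContDiffOn ℝ ∞ (tDeriv^[k] f) O := by
  induction k with
  | zero => simpa using hf
  | succ k ih => rw [iterate_succ']; exact ih.tDeriv hO

/-- `∂ₜ f (y, t)` is the derivative of the slice `t ↦ f (y, t)` (for `f` differentiable at
`(y, t)`). [folklore] -/
theorem tDeriv_apply_eq_deriv {f : E × ℝ → F} {y : E} {t : ℝ}
    (hf : DifferentiableAt ℝ f (y, t)) : tDeriv f (y, t) = deriv (fun s ↦ f (y, s)) t := by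
  have hι : HasDerivAt (fun s : ℝ ↦ ((y, s) : E × ℝ)) ((0 : E), (1 : ℝ)) t := by
    refine HasDerivAt.prodMk (hasDerivAt_const t y) ?_
    exact hasDerivAt_id' t
  have h := hf.hasFDerivAt.comp_hasDerivAt t hι
  rw [tDeriv_apply, ← h.deriv]
  rfl

/-- **Iterated time derivatives are iterated derivatives of the slices**: for `f` of class `C^∞`
on an open `O` and `(y, t) ∈ O`, `(∂ₜᵏ f)(y, t) = (d/ds)ᵏ|_{s=t} f(y, s)`. [folklore] -/
theorem iterate_tDeriv_apply_eq_iteratedDeriv {O : Set (E × ℝ)} (hO : IsOpen O) (k : ℕ) :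
    ∀ {f : E × ℝ → F}, ContDiffOn ℝ ∞ f O → ∀ {y : E} {t : ℝ}, (y, t) ∈ O →
      (tDeriv^[k] f) (y, t) = iteratedDeriv k (fun s ↦ f (y, s)) t := by
  induction k with
  | zero => intro f _ y t _; simp
  | succ k ih =>
    intro f hf y t hyt
    rw [iterate_succ_apply, ih (hf.tDeriv hO) hyt, iteratedDeriv_succ']
    -- the slices of `tDeriv f` and the derivative of the slices of `f` agree near `t`
    have hopen : IsOpen {s : ℝ | ((y, s) : E × ℝ) ∈ O} :=
      hO.preimage (Continuous.prodMk_right y)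
    refine Filter.EventuallyEq.iteratedDeriv_eq k ?_
    filter_upwards [hopen.mem_nhds hyt] with s hs
    exact tDeriv_apply_eq_deriv ((hf.contDiffAt (hO.mem_nhds hs)).differentiableAt (by simp))

/-! ### `∂ₜ` commutes with the total derivative -/

/-- **The time derivative commutes with the total derivative**: for `f` of class `C^∞` on an open
set `O` and `z ∈ O`, `∂ₜ (Df) (z) = D(∂ₜ f)(z)` as continuous linear maps — the symmetry of the
second derivative (`ContDiffAt.isSymmSndFDerivAt`). [folklore] -/
theorem tDeriv_fderiv {f : E × ℝ → F} {O : Set (E × ℝ)} (hf : ContDiffOn ℝ ∞ f O) (hO : IsOpen O)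
    {z : E × ℝ} (hz : z ∈ O) : tDeriv (fderiv ℝ f) z = fderiv ℝ (tDeriv f) z := by
  have hfz : ContDiffAt ℝ ∞ f z := hf.contDiffAt (hO.mem_nhds hz)
  have h2 : (2 : WithTop ℕ∞) ≤ ∞ := WithTop.coe_le_coe.2 (le_top (a := (2 : ℕ∞)))
  have hsymm : IsSymmSndFDerivAt ℝ f z :=
    hfz.isSymmSndFDerivAt (by simpa only [minSmoothness_of_isRCLikeNormedField] using h2)
  have hdf : DifferentiableAt ℝ (fderiv ℝ f) z :=
    ((hfz.fderiv_right (m := ∞) le_rfl).differentiableAt (by simp))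
  refine ContinuousLinearMap.ext fun w ↦ ?_
  -- `D(∂ₜ f)(z)(w) = D²f(z)(w)(0,1)` and `∂ₜ(Df)(z)(w) = D²f(z)(0,1)(w)`
  have h1 : fderiv ℝ (tDeriv f) z w = fderiv ℝ (fderiv ℝ f) z w ((0 : E), (1 : ℝ)) := by
    have : tDeriv f = fun z ↦ fderiv ℝ f z ((0 : E), (1 : ℝ)) := rfl
    rw [this, fderiv_clm_apply hdf (differentiableAt_const _)]
    simp
  rw [h1, tDeriv_apply]
  exact hsymm _ _

/-- Iterated form: `∂ₜᵏ (Df) = D(∂ₜᵏ f)` on `O`. [folklore] -/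
theorem iterate_tDeriv_fderiv {f : E × ℝ → F} {O : Set (E × ℝ)} (hf : ContDiffOn ℝ ∞ f O)
    (hO : IsOpen O) (k : ℕ) :
    EqOn (tDeriv^[k] (fderiv ℝ f)) (fun z ↦ fderiv ℝ (tDeriv^[k] f) z) O := by
  induction k with
  | zero => intro z _; simp
  | succ k ih =>
    intro z hz
    rw [iterate_succ_apply']
    have h1 : tDeriv (tDeriv^[k] (fderiv ℝ f)) z = tDeriv (fun z ↦ fderiv ℝ (tDeriv^[k] f) z) z :=
      tDeriv_congr_of_eventuallyEq (eventuallyEq_of_mem (hO.mem_nhds hz) ih)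
    rw [h1, tDeriv_fderiv (hf.iterate_tDeriv hO k) hO hz, iterate_succ_apply']

/-! ### Flatness in time on the hyperplane `{t = 0}` -/

/-- `f` is **flat in time on `O ∩ {t = 0}`**: all iterated time derivatives `∂ₜᵏ f`, `k ≥ 0`,
vanish at the points of `O` with time coordinate `0`. [folklore] -/
def IsTFlatOn (O : Set (E × ℝ)) (f : E × ℝ → F) : Prop :=
  ∀ (k : ℕ), ∀ z ∈ O, z.2 = 0 → (tDeriv^[k] f) z = 0

/-- Unfolding `IsTFlatOn`. [folklore] -/
theorem isTFlatOn_iff {O : Set (E × ℝ)} {f : E × ℝ → F} :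
    IsTFlatOn O f ↔ ∀ (k : ℕ), ∀ z ∈ O, z.2 = 0 → (tDeriv^[k] f) z = 0 :=
  Iff.rfl

namespace IsTFlatOn

variable {O : Set (E × ℝ)} {f : E × ℝ → F}

/-- A flat function vanishes on the hyperplane. [folklore] -/
theorem eq_zero (h : IsTFlatOn O f) {z : E × ℝ} (hz : z ∈ O) (hz0 : z.2 = 0) : f z = 0 :=
  h 0 z hz hz0

/-- Flatness is local on open sets. [folklore] -/
theorem congr (h : IsTFlatOn O f) (hO : IsOpen O) {g : E × ℝ → F} (hfg : EqOn f g O) :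
    IsTFlatOn O g := fun k z hz hz0 ↦ by
  rw [← iterate_tDeriv_eqOn hO hfg k hz]
  exact h k z hz hz0

/-- `∂ₜ f` is flat if `f` is. [folklore] -/
theorem tDeriv (h : IsTFlatOn O f) : IsTFlatOn O (tDeriv f) := fun k z hz hz0 ↦ by
  rw [← iterate_succ_apply]
  exact h (k + 1) z hz hz0

/-- In terms of the slices: `f`, `C^∞` on the open `O`, is flat iff all derivatives of the slices
`s ↦ f (y, s)` vanish at `s = 0` for `(y, 0) ∈ O`. [folklore] -/
theorem _root_.Literature.Analysis.Calculus.isTFlatOn_iff_iteratedDeriv (hO : IsOpen O)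
    (hf : ContDiffOn ℝ ∞ f O) :
    IsTFlatOn O f ↔ ∀ (k : ℕ) (y : E), ((y, (0 : ℝ)) : E × ℝ) ∈ O →
      iteratedDeriv k (fun s ↦ f (y, s)) 0 = 0 := by
  constructor
  · intro h k y hy
    rw [← iterate_tDeriv_apply_eq_iteratedDeriv hO k hf hy]
    exact h k _ hy rfl
  · rintro h k ⟨y, t⟩ hz (rfl : t = 0)
    rw [iterate_tDeriv_apply_eq_iteratedDeriv hO k hf hz]
    exact h k y hz

/-- **The total derivative of a flat function vanishes on the hyperplane**: horizontally because
`f` vanishes identically on the (relatively open) hyperplane piece, vertically because `∂ₜ f`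
does. [folklore] -/
theorem fderiv_eq_zero (h : IsTFlatOn O f) (hO : IsOpen O) (hf : ContDiffOn ℝ ∞ f O) {z : E × ℝ}
    (hz : z ∈ O) (hz0 : z.2 = 0) : fderiv ℝ f z = 0 := by
  obtain ⟨y, t⟩ := z
  simp only at hz0
  subst hz0
  -- horizontal directions: `f ∘ (·, 0)` vanishes near `y`
  have hι : HasFDerivAt (fun x : E ↦ ((x, (0 : ℝ)) : E × ℝ)) (ContinuousLinearMap.inl ℝ E ℝ) y :=
    (ContinuousLinearMap.inl ℝ E ℝ).hasFDerivAt.congr_of_eventuallyEq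
      (Eventually.of_forall fun x ↦ by simp)
  have hopen : IsOpen {x : E | ((x, (0 : ℝ)) : E × ℝ) ∈ O} := hO.preimage (Continuous.prodMk_left 0)
  have hzero : (fun x : E ↦ f (x, 0)) =ᶠ[𝓝 y] fun _ ↦ 0 := by
    filter_upwards [hopen.mem_nhds hz] with x hx
    exact h.eq_zero hx rfl
  have hfd : DifferentiableAt ℝ f (y, 0) := (hf.contDiffAt (hO.mem_nhds hz)).differentiableAt (by simp)
  have hcomp : fderiv ℝ (fun x : E ↦ f (x, 0)) y = (fderiv ℝ f (y, 0)).comp (ContinuousLinearMap.inl ℝ E ℝ) :=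
    (hfd.hasFDerivAt.comp y hι).fderiv
  have h0 : fderiv ℝ (fun x : E ↦ f (x, 0)) y = 0 := by
    rw [hzero.fderiv_eq]; simp
  have hhor : ∀ v : E, fderiv ℝ f (y, 0) (v, 0) = 0 := by
    intro v
    have := DFunLike.congr_fun hcomp v
    rw [h0] at this
    simpa using this.symm
  -- vertical direction: `∂ₜ f` vanishes
  have hver : fderiv ℝ f (y, 0) (0, 1) = 0 := h 1 _ hz rfl
  refine ContinuousLinearMap.ext fun p ↦ ?_
  obtain ⟨v, σ⟩ := p
  have hsplit : ((v, σ) : E × ℝ) = (v, 0) + σ • ((0 : E), (1 : ℝ)) := by simp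
  rw [hsplit, map_add, map_smul, hhor v, hver, smul_zero, add_zero, _root_.zero_apply]

/-- **Flatness passes to the total derivative** (`∂ₜᵏ (Df) = D(∂ₜᵏ f)` and the previous lemma
for the flat functions `∂ₜᵏ f`). [folklore] -/
theorem fderiv (h : IsTFlatOn O f) (hO : IsOpen O) (hf : ContDiffOn ℝ ∞ f O) :
    IsTFlatOn O (_root_.fderiv ℝ f) := fun k z hz hz0 ↦ by
  rw [iterate_tDeriv_fderiv hf hO k hz]
  have hk : IsTFlatOn O (Literature.Analysis.Calculus.tDeriv^[k] f) := by
    induction k with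
    | zero => simpa using h
    | succ k ih => rw [iterate_succ']; exact ih.tDeriv
  exact hk.fderiv_eq_zero hO (hf.iterate_tDeriv hO k) hz hz0

/-! ### The gluing theorem -/

omit [NormedSpace ℝ E] [NormedSpace ℝ F] in
/-- Near a point with `t > 0` the cut-off function is the function. [folklore] -/
theorem cutoff_eventuallyEq_of_pos (g : E × ℝ → F) {z : E × ℝ} (hz : 0 < z.2) :
    (fun w : E × ℝ ↦ if 0 < w.2 then g w else 0) =ᶠ[𝓝 z] g := by
  have hopen : IsOpen {w : E × ℝ | 0 < w.2} := isOpen_lt continuous_const continuous_snd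
  filter_upwards [hopen.mem_nhds hz] with w hw
  exact if_pos hw

omit [NormedSpace ℝ E] [NormedSpace ℝ F] in
/-- Near a point with `t < 0` the cut-off function vanishes. [folklore] -/
theorem cutoff_eventuallyEq_of_neg (g : E × ℝ → F) {z : E × ℝ} (hz : z.2 < 0) :
    (fun w : E × ℝ ↦ if 0 < w.2 then g w else 0) =ᶠ[𝓝 z] fun _ ↦ 0 := by
  have hopen : IsOpen {w : E × ℝ | w.2 < 0} := isOpen_lt continuous_snd continuous_const
  filter_upwards [hopen.mem_nhds hz] with w hw
  exact if_neg (not_lt.2 hw.le)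

omit [NormedAddCommGroup E] [NormedSpace ℝ E] [NormedSpace ℝ F] in
/-- The cut-off is dominated by the function: `‖cut g w‖ ≤ ‖g w‖`. [folklore] -/
theorem norm_cutoff_le (g : E × ℝ → F) (w : E × ℝ) :
    ‖(if 0 < w.2 then g w else 0 : F)‖ ≤ ‖g w‖ := by
  split_ifs
  · exact le_rfl
  · simp

/-- **The derivative of the cut-off of a flat function**: at every point of `O` the cut-off
`z ↦ (t > 0 ? f z : 0)` has derivative the cut-off of `Df` — off the hyperplane trivially, on the
hyperplane because `f = o(‖w − z‖)` there (`f(z) = 0`, `Df(z) = 0`) dominates the cut-off.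
[folklore] -/
theorem hasFDerivAt_cutoff (h : IsTFlatOn O f) (hO : IsOpen O) (hf : ContDiffOn ℝ ∞ f O)
    {z : E × ℝ} (hz : z ∈ O) :
    HasFDerivAt (fun w : E × ℝ ↦ if 0 < w.2 then f w else 0)
      (if 0 < z.2 then _root_.fderiv ℝ f z else 0) z := by
  have hfd : DifferentiableAt ℝ f z := (hf.contDiffAt (hO.mem_nhds hz)).differentiableAt (by simp)
  rcases lt_trichotomy z.2 0 with hneg | hzero | hpos
  · rw [if_neg (not_lt.2 hneg.le)]
    exact (hasFDerivAt_const (0 : F) z).congr_of_eventuallyEq (cutoff_eventuallyEq_of_neg f hneg)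
  · rw [if_neg (by rw [hzero]; exact lt_irrefl 0)]
    have hf0 : f z = 0 := h.eq_zero hz hzero
    have hDf0 : _root_.fderiv ℝ f z = 0 := h.fderiv_eq_zero hO hf hz hzero
    -- `f w = o(w - z)`
    have hlo : (fun w ↦ f w) =o[𝓝 z] fun w ↦ w - z := by
      have := hfd.hasFDerivAt.isLittleO
      rw [hDf0] at this
      simpa [hf0] using this
    have hbig : (fun w : E × ℝ ↦ (if 0 < w.2 then f w else 0 : F)) =O[𝓝 z] fun w ↦ f w :=
      IsBigO.of_bound 1 (Eventually.of_forall fun w ↦ by simpa using norm_cutoff_le f w)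
    have hlo' := hbig.trans_isLittleO hlo
    refine .of_isLittleO ?_
    refine hlo'.congr' (Eventually.of_forall fun w ↦ ?_) EventuallyEq.rfl
    have hz' : ¬ (0 : ℝ) < z.2 := by rw [hzero]; exact lt_irrefl 0
    simp [hz']
  · rw [if_pos hpos]
    exact hfd.hasFDerivAt.congr_of_eventuallyEq (cutoff_eventuallyEq_of_pos f hpos)

/-- Continuity of the cut-off of a flat continuous(ly differentiable) function. [folklore] -/
theorem continuousOn_cutoff (h : IsTFlatOn O f) (hO : IsOpen O) (hf : ContDiffOn ℝ ∞ f O) :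
    ContinuousOn (fun w : E × ℝ ↦ if 0 < w.2 then f w else 0) O := fun _ hz ↦
  ((h.hasFDerivAt_cutoff hO hf hz).continuousAt).continuousWithinAt

/-- **Gluing theorem.** If `f : E × ℝ → F` is `C^∞` on an open set `O` and flat in time on
`O ∩ {t = 0}` (all `∂ₜᵏ f` vanish there), then the function equal to `f` for `t > 0` and to `0`
for `t ≤ 0` is `C^∞` on `O`. Induction on the order through `contDiffOn_succ_iff_fderiv_of_isOpen`:
the cut-off is differentiable with derivative the cut-off of `Df` (`hasFDerivAt_cutoff`), and `Df`
is again `C^∞` and flat (`IsTFlatOn.fderiv`). [folklore] -/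
theorem contDiffOn_cutoff (h : IsTFlatOn O f) (hO : IsOpen O) (hf : ContDiffOn ℝ ∞ f O) :
    ContDiffOn ℝ ∞ (fun w : E × ℝ ↦ if 0 < w.2 then f w else 0) O := by
  suffices key : ∀ (n : ℕ) {G : Type u} [NormedAddCommGroup G] [NormedSpace ℝ G] {g : E × ℝ → G},
      IsTFlatOn O g → ContDiffOn ℝ ∞ g O →
        ContDiffOn ℝ n (fun w : E × ℝ ↦ if 0 < w.2 then g w else 0) O by
    rw [contDiffOn_infty]
    intro n
    exact key n h hf
  intro n
  induction n with
  | zero =>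
    intro G _ _ g hg hgs
    rw [Nat.cast_zero, contDiffOn_zero]
    exact hg.continuousOn_cutoff hO hgs
  | succ n ih =>
    intro G _ _ g hg hgs
    have hderiv : ∀ z ∈ O, HasFDerivAt (fun w : E × ℝ ↦ if 0 < w.2 then g w else 0)
        (if 0 < z.2 then _root_.fderiv ℝ g z else 0) z := fun z hz ↦ hg.hasFDerivAt_cutoff hO hgs hz
    rw [show ((n + 1 : ℕ) : WithTop ℕ∞) = (n : WithTop ℕ∞) + 1 by push_cast; rfl,
      contDiffOn_succ_iff_fderiv_of_isOpen hO]
    refine ⟨fun z hz ↦ (hderiv z hz).differentiableAt.differentiableWithinAt, by simp, ?_⟩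
    have ih' := ih (hg.fderiv hO hgs) (hgs.fderiv_of_isOpen hO le_rfl)
    exact ih'.congr fun z hz ↦ (hderiv z hz).fderiv

end IsTFlatOn

end Literature.Analysis.Calculus

end
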